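import Summits.BirchSwinnertonDyer.BirchSwinnertonDyer.Theses.PAdicOrderV2
import Summits.BirchSwinnertonDyer.BirchSwinnertonDyer.Theses.PAdicOrder
import Summits.BirchSwinnertonDyer.BirchSwinnertonDyer.Theses.SelmerRank
import Summits.BirchSwinnertonDyer.BirchSwinnertonDyer.Theorems.PAdicOrderV2PAdicOrderComparisonR2OddOfItems
import Summits.BirchSwinnertonDyer.BirchSwinnertonDyer.Theorems.PAdicOrderV2PAdicOrderComparisonR2ResidueTwoAligned
import Literature.NumberTheory.EllipticCurves.KatoRankBound

/-!
# Crux #2 `PAdicOrderComparisonR2` — exactness of skeleton v13 (line `Sketch`, lead c5)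

Crux (stmt-BirchSwinnertonDyer-0489): for `E/ℚ` (globally minimal `W`), every good ordinary prime `p`
and the newform `f` of `E`, `ord_{T=0} L_p(f, α_p, T) = ord_{s=1} L(E, s)`.

Skeleton v13 (`Cruxes/PAdicOrderComparisonR2/Lines/Sketch.lean`) proves the crux from six route items
(`SelmerRankLB/UB/SmallImage/ShaPFinite`, `PAdicOrderSemisimpleR3`, `PAdicOrderMainConjectureR7`) and
two registered `p = 2` stubs, shared verbatim with crux #3's line (stmt-BirchSwinnertonDyer-0490):
* K2 `stub_katoAllPrimes` — the ∀-closure of the Literature fact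
  `kato_selmerCorank_le_order_padicLFunction_allPrimes` (`corank Sel_{p^∞} ≤ ord_T L_p` at every
  good ordinary prime; Kato, Astérisque 295, Thm 18.4 as printed);
* NE2⁺ `stub_noExcessTwoPos` — `ord_T L_2 ≤ corank Sel_{2^∞}` in positive rank (open beyond print).

This file certifies that the decomposition is EXACT modulo route SelmerRank's four items: both stubs
are consequences of the crux together with `SelmerRankLB ∧ SelmerRankUB ∧ SelmerRankSmallImage ∧
SelmerRankShaPFinite` (whence `corank_{ℤ_p} Sel_{p^∞}(E/ℚ) = r_an(E)`, landed
`selmerCorank_eq_analyticRank_of_selmerRankItems`), and conversely (landed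
`pAdicOrderComparisonR2_of_sixRouteItems_kato_noExcessTwo`, p138680) the six items and the two stubs
give the crux. Hence, granting the six route items, crux #2 ⇔ K2 ∧ NE2⁺: neither stub can fail while
the crux and route SelmerRank hold, and the standing disprover has no stub-level target cheaper than
the crux itself (as for v4, `Disproof.lean` §4 `stubs_of_crux`). Pure bookkeeping in `ℕ∞`.
-/

set_option linter.dupNamespace false

namespace Summit.BirchSwinnertonDyer.BirchSwinnertonDyer.Theorems

open Summit.BirchSwinnertonDyer.BirchSwinnertonDyer.Theses.PAdicOrderV2
open Summit.BirchSwinnertonDyer.BirchSwinnertonDyer.Theses.SelmerRank (SelmerRankLB SelmerRankUB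
  SelmerRankSmallImage SelmerRankShaPFinite)
open Literature.NumberTheory.EllipticCurves

/-- **Stub K2 is a consequence of crux #2 and route SelmerRank's items.** If `ord_{T=0} L_p(E,T) =
r_an(E)` at every good ordinary prime (crux #2) and `corank_{ℤ_p} Sel_{p^∞}(E/ℚ) = r_an(E)` (from
`SelmerRankLB/UB/SmallImage/ShaPFinite`), then Kato's Selmer-corank bound
`corank Sel_{p^∞} ≤ ord_T L_p` holds at every good ordinary prime, `p = 2` included — i.e. the
registered stub `stub_katoAllPrimes` verbatim. [folklore] -/
theorem katoAllPrimes_of_pAdicOrderComparisonR2_of_selmerRankItems :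
    Summit.BirchSwinnertonDyer.BirchSwinnertonDyer.Theses.PAdicOrderV2.PAdicOrderComparisonR2 →
    Summit.BirchSwinnertonDyer.BirchSwinnertonDyer.Theses.SelmerRank.SelmerRankLB →
    Summit.BirchSwinnertonDyer.BirchSwinnertonDyer.Theses.SelmerRank.SelmerRankUB →
    Summit.BirchSwinnertonDyer.BirchSwinnertonDyer.Theses.SelmerRank.SelmerRankSmallImage →
    Summit.BirchSwinnertonDyer.BirchSwinnertonDyer.Theses.SelmerRank.SelmerRankShaPFinite →
    (∀ (W : WeierstrassCurve ℚ) [W.IsElliptic] [W.IsGloballyMinimal] (p : ℕ) [Fact p.Prime]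
      {N : ℕ} [NeZero N] (f : CuspForm (CongruenceSubgroup.Gamma0 N) 2),
      Literature.NumberTheory.EllipticCurves.kato_selmerCorank_le_order_padicLFunction_allPrimes W p
        (f := f)) := by
  intro h2 hLB hUB hSI hSha W _ _ p _ N _ f hord hf
  rw [h2 W p hord f hf, selmerCorank_eq_analyticRank_of_selmerRankItems hLB hUB hSI hSha W p]

/-- **Stub NE2⁺ is a consequence of crux #2 and route SelmerRank's items.** If `ord_{T=0} L_p(E,T)
= r_an(E)` at every good ordinary prime (crux #2) and `corank_{ℤ_p} Sel_{p^∞}(E/ℚ) = r_an(E)`, then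
at `p = 2` (indeed at every prime, in every rank) `ord_T L_2(E,T) ≤ corank_{ℤ_2} Sel_{2^∞}(E/ℚ)` —
the registered stub `stub_noExcessTwoPos` verbatim. [folklore] -/
theorem noExcessTwoPos_of_pAdicOrderComparisonR2_of_selmerRankItems :
    Summit.BirchSwinnertonDyer.BirchSwinnertonDyer.Theses.PAdicOrderV2.PAdicOrderComparisonR2 →
    Summit.BirchSwinnertonDyer.BirchSwinnertonDyer.Theses.SelmerRank.SelmerRankLB →
    Summit.BirchSwinnertonDyer.BirchSwinnertonDyer.Theses.SelmerRank.SelmerRankUB →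
    Summit.BirchSwinnertonDyer.BirchSwinnertonDyer.Theses.SelmerRank.SelmerRankSmallImage →
    Summit.BirchSwinnertonDyer.BirchSwinnertonDyer.Theses.SelmerRank.SelmerRankShaPFinite →
    (∀ (W : WeierstrassCurve ℚ) [W.IsElliptic] [W.IsGloballyMinimal] (p : ℕ) [Fact p.Prime],
      p = 2 → Literature.NumberTheory.EllipticCurves.IsOrdinaryAt W p →
      ∀ {N : ℕ} [NeZero N] (f : CuspForm (CongruenceSubgroup.Gamma0 N) 2),
        Literature.NumberTheory.EllipticCurves.ModularForms.IsNewformOf W f →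
      1 ≤ W.mordellWeilRank →
      (Literature.NumberTheory.EllipticCurves.padicLFunction f
        (Literature.NumberTheory.EllipticCurves.unitRoot W p : ℚ_[p])).order ≤ W.selmerCorank p) := by
  intro h2 hLB hUB hSI hSha W _ _ p _ _ hord N _ f hf _
  rw [h2 W p hord f hf, selmerCorank_eq_analyticRank_of_selmerRankItems hLB hUB hSI hSha W p]

/-- **Exactness of skeleton v13.** Granting the six route items `SelmerRankLB`, `SelmerRankUB`,
`SelmerRankSmallImage`, `SelmerRankShaPFinite`, `PAdicOrderSemisimpleR3` (crux #4, stmt-0509) and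
`PAdicOrderMainConjectureR7` (crux #7, stmt-15426), crux #2 `PAdicOrderComparisonR2` is EQUIVALENT
to the conjunction of its two registered `p = 2` stubs K2 (`stub_katoAllPrimes`, Kato's corank bound
at every good ordinary prime) and NE2⁺ (`stub_noExcessTwoPos`, no excess zeros of `L_2` in positive
rank): `⇐` is the landed v13 composition `pAdicOrderComparisonR2_of_sixRouteItems_kato_noExcessTwo`,
`⇒` the two lemmas above (which use only the four SelmerRank items). [folklore] -/
theorem pAdicOrderComparisonR2_iff_stubs_of_sixRouteItems :
    Summit.BirchSwinnertonDyer.BirchSwinnertonDyer.Theses.SelmerRank.SelmerRankLB →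
    Summit.BirchSwinnertonDyer.BirchSwinnertonDyer.Theses.SelmerRank.SelmerRankUB →
    Summit.BirchSwinnertonDyer.BirchSwinnertonDyer.Theses.SelmerRank.SelmerRankSmallImage →
    Summit.BirchSwinnertonDyer.BirchSwinnertonDyer.Theses.SelmerRank.SelmerRankShaPFinite →
    Summit.BirchSwinnertonDyer.BirchSwinnertonDyer.Theses.PAdicOrderV2.PAdicOrderSemisimpleR3 →
    Summit.BirchSwinnertonDyer.BirchSwinnertonDyer.Theses.PAdicOrderV2.PAdicOrderMainConjectureR7 →
    (Summit.BirchSwinnertonDyer.BirchSwinnertonDyer.Theses.PAdicOrderV2.PAdicOrderComparisonR2 ↔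
      ((∀ (W : WeierstrassCurve ℚ) [W.IsElliptic] [W.IsGloballyMinimal] (p : ℕ) [Fact p.Prime]
          {N : ℕ} [NeZero N] (f : CuspForm (CongruenceSubgroup.Gamma0 N) 2),
          Literature.NumberTheory.EllipticCurves.kato_selmerCorank_le_order_padicLFunction_allPrimes
            W p (f := f)) ∧
        (∀ (W : WeierstrassCurve ℚ) [W.IsElliptic] [W.IsGloballyMinimal] (p : ℕ) [Fact p.Prime],
          p = 2 → Literature.NumberTheory.EllipticCurves.IsOrdinaryAt W p →
          ∀ {N : ℕ} [NeZero N] (f : CuspForm (CongruenceSubgroup.Gamma0 N) 2),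
            Literature.NumberTheory.EllipticCurves.ModularForms.IsNewformOf W f →
          1 ≤ W.mordellWeilRank →
          (Literature.NumberTheory.EllipticCurves.padicLFunction f
            (Literature.NumberTheory.EllipticCurves.unitRoot W p : ℚ_[p])).order ≤
            W.selmerCorank p))) :=
  fun hLB hUB hSI hSha hSS hMC =>
    ⟨fun h2 => ⟨katoAllPrimes_of_pAdicOrderComparisonR2_of_selmerRankItems h2 hLB hUB hSI hSha,
        noExcessTwoPos_of_pAdicOrderComparisonR2_of_selmerRankItems h2 hLB hUB hSI hSha⟩,
      fun h => pAdicOrderComparisonR2_of_sixRouteItems_kato_noExcessTwo hLB hUB hSI hSha hSS hMC h.1 h.2⟩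

end Summit.BirchSwinnertonDyer.BirchSwinnertonDyer.Theorems
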